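import Literature.NumberTheory.EllipticCurves.KuriharaNumberKimCertificate
import Literature.NumberTheory.EllipticCurves.LeadingTermPPartProofs
import Literature.NumberTheory.EllipticCurves.Rank1Residual.PeriodUnitProofs
import HarnessLib

/-!
# The `L`-value at a deep modulus: `δ̃_1 = [0]⁺ ≡ p^v · (unit) (mod p^K)` with
# `v = ord_p(L(E,1)/Ω_E)`, and the `p`-integrality of the symbols at Kolyvagin levels
# (team n1011, ROUTE-1 sub-target R1-23, skeleton `cells/n1011/skel/T-R1-23.md` bridges B3/B4; p18)

HONEST FRAMING (cell `b2b-bsdres`, run/shared/lean/b2b/bsd-rank1-residual/, verbatim in every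
file): the goal of the cell is to DELETE the COMBINATION-SHAPED residual classes of the
Birch–Swinnerton-Dyer formula for ALL analytic-rank `≤ 1` elliptic curves over `ℚ` — "full BSD
formula for every rank `≤ 1` curve in class `C`" assembled STRICTLY from published theorems — so
that the rank-`≤ 1` remainder becomes exactly the CONSTRUCTION-SHAPED classes, which are TYPED
(missing-input `Prop`s), NOT attempted. This is not "finishing BSD". Team n1011 (N10/N11, the
additive block `X4 ∧ p = 3`): research route; TOOL theorems, no class theorem, nothing booked, no
mark changed, no fact.

## What and why

The deep half of the (a′) assembly (`KuriharaLowerBoundAssembly`) takes the `L`-value in the shape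
`hLval : ∃ w₀, ∀ ψ, kuriharaNumber f (p^K) 1 ψ = p^v · w₀` (a unit `w₀` of `ℤ/p^K`).  Here it is
derived from the tree's normalisation (`kuriharaNumber_one : δ̃_1 = ratModP (p^K) [0]⁺_f`,
`ratModP_eq_toZModPow`) and the `p`-adic factorisation in `ℤ_p` (`PadicInt.unitCoeff_spec`):
`exists_unit_ratModP_eq_pow_mul` (`ratModP (p^K) q = p^{ord_p q} · unit` for a `p`-integral
`q ≠ 0`), `exists_unit_kuriharaNumber_one_eq`, and — for an elliptic curve `W/ℚ` with newform datum
`P`, `E[p]` irreducible, `p` odd, `L(E,1) ≠ 0`, period transfer `Ω(W) = u·Ω⁺_f`, `|u|_p = 1` —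
`exists_lValue_witness`: `∃ q v, L(E,1)/Ω(W) = q ∧ padicValRat p q = v ∧` the `hLval` shape at
every modulus `p^K` (the currency of R23_endshape's conclusion).  Also the `p`-integrality of the
symbols `[a/m]⁺_f` at levels `m` prime to the conductor (`coprime_den_ratPlusSymbol_of_coprime`),
the shape of the shallow half's hypothesis `hden`.

References: C.-H. Kim, AJM 148 (2026) §1.4.1, §1.4.3 [Kim2022StructureSelmer]; B. Mazur, J. Tate,
J. Teitelbaum, Invent. Math. 84 (1986) §I.8 [MazurTateTeitelbaum1986Invent].
-/

noncomputable section

open scoped Classical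

namespace Summit.BirchSwinnertonDyer.Rank1Residual.GaloisImage.LValue

open Literature.NumberTheory.EllipticCurves Literature.NumberTheory.EllipticCurves.ModularForms
open Literature.NumberTheory.DiophantineGeometry.Dioph (ratModP)
open CongruenceSubgroup

/-! ## `ratModP (p^K) q = p^{ord_p q} · unit` -/

/-- **A `p`-integral non-zero rational reduces mod `p^K` to `p^{ord_p q}` times a unit.**
[folklore] -/
theorem exists_unit_ratModP_eq_pow_mul {p : ℕ} [hp : Fact p.Prime] (K : ℕ) {q : ℚ} (hq0 : q ≠ 0)
    (hq : ¬ p ∣ q.den) {v : ℕ} (hv : padicValRat p q = v) :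
    ∃ w : (ZMod (p ^ K))ˣ, ratModP (p ^ K) q = ((p ^ v : ℕ) : ZMod (p ^ K)) * (w : ZMod (p ^ K)) := by
  rw [ratModP_eq_toZModPow p K hq]
  set x : ℤ_[p] := ⟨(q : ℚ_[p]), Padic.norm_rat_le_one hq⟩ with hx
  have hx0 : x ≠ 0 := by
    intro h
    apply hq0
    have h' : ((q : ℚ_[p])) = 0 := by
      have := congrArg (fun y : ℤ_[p] => (y : ℚ_[p])) h
      simpa [hx] using this
    exact_mod_cast h'
  have hval : x.valuation = v := by
    have h1 : ((x.valuation : ℕ) : ℤ) = padicValRat p q := by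
      rw [← PadicInt.valuation_coe, show ((x : ℤ_[p]) : ℚ_[p]) = (q : ℚ_[p]) from rfl,
        Padic.valuation_ratCast]
    exact_mod_cast h1.trans hv
  refine ⟨(PadicInt.unitCoeff hx0).map (PadicInt.toZModPow K).toMonoidHom, ?_⟩
  conv_lhs => rw [PadicInt.unitCoeff_spec hx0]
  rw [map_mul, map_pow, map_natCast, hval, Units.coe_map]
  simp [mul_comm]

/-- **`δ̃_1 ≡ p^v · unit (mod p^K)`** for every choice of discrete logarithms (`δ̃_1 = [0]⁺`,
`kuriharaNumber_one`), when `[0]⁺_f ≠ 0` is `p`-integral with `ord_p [0]⁺_f = v`.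
[cite: Kim2022StructureSelmer, §1.4.3 (PDF p. 7)] -/
theorem exists_unit_kuriharaNumber_one_eq {p : ℕ} [Fact p.Prime] {N : ℕ} (f : CuspForm (Gamma0 N) 2)
    (K : ℕ) (h0 : ratPlusSymbol f 0 ≠ 0) (hint : ¬ p ∣ (ratPlusSymbol f 0).den) {v : ℕ}
    (hv : padicValRat p (ratPlusSymbol f 0) = v) :
    ∃ w₀ : (ZMod (p ^ K))ˣ, ∀ ψ : (ℓ : ℕ) → (ZMod ℓ)ˣ →* Multiplicative (ZMod (p ^ K)),
      kuriharaNumber f (p ^ K) 1 ψ = ((p ^ v : ℕ) : ZMod (p ^ K)) * (w₀ : ZMod (p ^ K)) := by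
  obtain ⟨w, hw⟩ := exists_unit_ratModP_eq_pow_mul K h0 hint hv
  exact ⟨w, fun ψ => by rw [kuriharaNumber_one, hw]⟩

/-! ## The curve-level witness -/

/-- **The `L`-value witness of an analytic-rank-`0` curve at an odd prime `p` with `E[p]`
irreducible**: with the newform datum `P` and the period transfer `Ω(W) = u·Ω⁺_f`, `|u|_p = 1`,
there are `q ∈ ℚ` and `v ∈ ℕ` with `L(E,1)/Ω(W) = q`, `ord_p q = v`, and, at EVERY modulus `p^K`,
`δ̃_1 = [0]⁺_f ≡ p^v · (unit)` — the shapes consumed by `KuriharaLowerBoundAssembly` (`hLval`) and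
produced by R23_endshape's conclusion.  (`L(E,1) = [0]⁺_f · Ω⁺_f`: `IsNewformOf.entireLFunction_one_eq`;
`p`-integrality of `[0]⁺_f`: `IsNewformOf.norm_ratPlusSymbol_le_one`.)
[cite: Kim2022StructureSelmer, §1.4.1 and §1.4.3 (PDF p. 7)] -/
theorem exists_lValue_witness (W : WeierstrassCurve ℚ) [W.IsElliptic] [W.IsGloballyMinimal]
    (p : ℕ) [Fact p.Prime]
    (hp2 : p ≠ 2) (hirr : W.HasIrreducibleModPGaloisRep p) (hL : W.entireLFunction 1 ≠ 0)
    {N : ℕ} [NeZero N] (P : ModularParametrizationData W N)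
    (hper : ∃ u : ℚ, ‖(u : ℚ_[p])‖ = 1 ∧ W.realPeriodRat = u * plusPeriod P.f) :
    ∃ (q : ℚ) (v : ℕ), W.entireLFunction 1 / (W.realPeriodRat : ℂ) = (q : ℂ) ∧
      padicValRat p q = v ∧
      ∀ K : ℕ, ∃ w₀ : (ZMod (p ^ K))ˣ,
        ∀ ψ : (ℓ : ℕ) → (ZMod ℓ)ˣ →* Multiplicative (ZMod (p ^ K)),
          kuriharaNumber P.f (p ^ K) 1 ψ = ((p ^ v : ℕ) : ZMod (p ^ K)) * (w₀ : ZMod (p ^ K)) := by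
  have hint : ¬ p ∣ (ratPlusSymbol P.f 0).den :=
    not_dvd_den_of_norm_ratCast_le_one
      (P.isNewformOf.norm_ratPlusSymbol_le_one (x := 0) hp2 hirr (by simp))
  have hLeq := P.isNewformOf.entireLFunction_one_eq
  have hne : ratPlusSymbol P.f 0 ≠ 0 := by
    intro h0
    apply hL
    rw [hLeq, h0]
    simp
  have hv0 : 0 ≤ padicValRat p (ratPlusSymbol P.f 0) := by
    unfold padicValRat
    rw [padicValNat.eq_zero_of_not_dvd hint]
    simp
  obtain ⟨u, hu, hΩ⟩ := hper
  have hu0 : u ≠ 0 := by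
    rintro rfl
    rw [Rat.cast_zero, norm_zero] at hu
    exact zero_ne_one hu
  have hΩf : 0 < plusPeriod P.f :=
    IsNewform0.plusPeriod_pos_holds P.isNewformOf.1 P.isNewformOf.coeffField_eq_bot
  set v : ℕ := (padicValRat p (ratPlusSymbol P.f 0)).toNat with hvdef
  have hv : padicValRat p (ratPlusSymbol P.f 0) = v := by
    rw [hvdef, Int.toNat_of_nonneg hv0]
  refine ⟨ratPlusSymbol P.f 0 / u, v, ?_, ?_, fun K => exists_unit_kuriharaNumber_one_eq P.f K hne hint hv⟩
  · rw [hLeq, hΩ]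
    have hu' : (u : ℂ) ≠ 0 := by exact_mod_cast hu0
    have hΩf' : ((plusPeriod P.f : ℝ) : ℂ) ≠ 0 := by exact_mod_cast hΩf.ne'
    push_cast
    field_simp
  · rw [padicValRat.div hne hu0, Literature.NumberTheory.EllipticCurves.Rank1Residual.padicValRat_eq_zero_of_norm_ratCast_eq_one hu,
      sub_zero, hv]

/-! ## `p`-integrality of the symbols at levels prime to the conductor -/

/-- **The symbols `[a/m]⁺_f` at a level `m` prime to `N` are `p`-integral** (`E[p]` irreducible,
`p` odd): the denominator of `[a/m]⁺_f` is prime to `p^K` — the shape of the shallow half's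
hypothesis `hden` at Kolyvagin levels (square-free products of primes not dividing `N`).
[cite: Kim2022StructureSelmer, §1.4.1 (PDF p. 7)] -/
theorem coprime_den_ratPlusSymbol_of_coprime (W : WeierstrassCurve ℚ) [W.IsElliptic]
    [W.IsGloballyMinimal] (p : ℕ)
    [hp : Fact p.Prime] (hp2 : p ≠ 2) (hirr : W.HasIrreducibleModPGaloisRep p)
    {N : ℕ} [NeZero N] (P : ModularParametrizationData W N) {m : ℕ} (hm : Nat.Coprime m N)
    (K a : ℕ) : (ratPlusSymbol P.f ((a : ℚ) / m)).den.Coprime (p ^ K) := by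
  have h1 : ‖((ratPlusSymbol P.f (((a : ℤ) : ℚ) / m) : ℚ) : ℚ_[p])‖ ≤ 1 :=
    P.isNewformOf.norm_ratPlusSymbol_div_le_one hp2 hirr hm a
  rw [Int.cast_natCast] at h1
  have h2 := not_dvd_den_of_norm_ratCast_le_one h1
  exact Nat.Coprime.pow_right K ((Nat.Prime.coprime_iff_not_dvd hp.out).2 h2).symm

end Summit.BirchSwinnertonDyer.Rank1Residual.GaloisImage.LValue

end
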